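import Mathlib
import HarnessLib
import HarnessLib.Audit
import Summits.BirchSwinnertonDyer.Statement
import Summits.BirchSwinnertonDyer.BirchSwinnertonDyer.Theses.PolyaAxisDoorRankThree
import HarnessLib.Audit.Status.Attr

/-!
Route: WashingtonSignFamilyDoorRankThree

# Route WashingtonSignFamilyDoorRankThree — Constant-root-number family door — Washington's w = −1
family with three points; rank-3 heart = no rank jump ∧ L‴ ≠ 0

It suffices to show X = S ∧ Q ∧ P on Washington's family E_t : y² = x³ + t·x² − (t+3)·x + 1 (the
elliptic curves of Shanks' simplest cubic fields) restricted to the three-point sub-family t = 2s² +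
2s − 1 (2t+3 = (2s+1)², extra points (2, 2s+1), (−1, 2s+1) next to (0,1)): S (SUPPLY, the one open
input) = for infinitely many integers s ≥ 2, s ≡ 2 (mod 5005), the minimal model W of E_t(s) has
rank ≤ 3 (NO rank jump beyond the three points) AND L‴(W,1) ≠ 0; Q (support, provable by a periodic
kernel certificate at 5·7·11·13) = 3 ≤ rank on every fibre of that progression; P (PRINT PACK) =
Rizzo 2003 «w(E_t) = −1 for every t ∈ ℤ» ∧ L(E,s) entire (BCDT, tree fact by name) ∧
Gross–Zagier–Kolyvagin (tree fact by name). KERNEL (support, provable now, 6 lines in the seat's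
Sketch6.lean): on any integer fibre, w = −1 ⇒ r_an odd, rank ≥ 2 ⇒ r_an ≥ 2 (GZK), L‴ ≠ 0 ⇒ r_an ≤ 3
(analyticRank_le_of_iteratedDeriv_ne_zero), so r_an = 3 and rank = 3 ⇒ every member lies in the leaf
«T-r3An» InfinitelyManyRankThreeBSD (the SAME Prop as route PolyaAxisDoorRankThree's target; born
DRAFT by design until the rung token is registered, exactly as LINES 3/4/5). A DOOR: no class
theorem at rank ≥ 2, BSD is NOT proved.
Lean: `WashingtonSupplyRankThree ∧ WashingtonThreePoints ∧ PublishedInputsWashington`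

## Assembly
closes (6 lines, sorry-free, certified by `ledger route check --native`): Set.Infinite.mono — a
member (s, W) of the supply set gets 3 ≤ rank from the three-point support, then the kernel (fed the
print pack, fibre t = 2s²+2s−1) returns rank = 3 ∧ r_an = 3, i.e. W is a member of the leaf set with
the same discriminant. The Assembly item records the same implication chain (provable now by the
identical term).

CLOSES_TARGET: closes rung T-r3A of BirchSwinnertonDyer: Summit.BirchSwinnertonDyer.BirchSwinnertonDyer.Theses.PolyaAxisDoorRankThree.InfinitelyManyRankThreeBSD (D-0061; not the summit Statement) — the deciding theorem of this route concludes that registered leaf instead of the Statement decl `BirchSwinnertonDyer` (class rung: servable and labelled, never counted as concluding the summit Statement).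

Rationale: WHY THIS LINE. A rank-3 door needs four things on each member: w = −1, rank ≥ 3, rank ≤ 3, L‴(E,1) ≠
0; in every listed door the first two are a THIN arithmetic condition that must be intersected with
the open analytic one. Washington's family makes both thin conditions IDENTICALLY TRUE along an
explicit polynomial family: w(E_t) = −1 for all t ∈ ℤ is a theorem (Rizzo2003 §1; Desjardins
[corpus:paper:arxiv-2011.02386 p.3]: «W(𝒲(t)) = −1 for every integer t [Riz]»), and on t = 2s²+2s−1
three explicit points are independent on every fibre of a progression by a PERIODIC kernel
certificate (reductions of the fibre and of the points depend only on s mod q; kit j296053: q ∈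
{5,7,11,13} kill all seven 𝔽₂-combinations and the torsion for s ≡ 2 (mod 5005); fibres are
torsion-free anyway, Duquesne2001 / DelaunayDuquesne2003 Thm 2.2) — so the heart is reduced to the
two GENERIC conditions «no further rank jump» and «L‴ ≠ 0» along one polynomial family. The imported
area is the arithmetic of cyclic cubic fields: by Washington1987 Thm 1
[corpus:paper:doi-10-1090-s0025-5718-1987-0866122-8 p.5] rank E_t(ℚ) ≤ 1 + rk₂ Cl(K_t) with an exact
sequence 1 → E°(ℚ)/2E(ℚ) → Cl(K_t)[2] → Ш(E_t)[2] → 1, so «rank ≤ 3» on a fibre is a 2-RANK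
CONDITION ON THE CLASS GROUP of the simplest cubic field K_t (Washington proves rank E₁₁(ℚ) = 3
exactly this way, p.12: h(K₁₁) = 4) — class-group statistics of a monogenic cubic family
(Bhargava–Hanke–Shankar-type averages of #Cl[2]) become a tool for the algebraic half, while the
analytic half is an OPEN condition (a strict inequality certified per member, never a vanishing). No
listed route or negative uses a constant-root-number family, Washington's descent, or class groups
of cubic fields (rg over Theses: «Washington» occurs only as Ferrero–Washington / Washington1997
cyclotomic units); DelaunayDuquesne2003 computed L⁽³⁾, L⁽⁵⁾ on this family numerically (27 % of m ≤
14000 have analytic rank ≥ 3) but proved nothing about infinitude; BDD arXiv:1612.03095 / Desjardins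
obtain rank ELEVATION on such families only conditionally on the parity conjecture, whereas here w =
−1 is used on the ANALYTIC side only, unconditionally. Technique card «splitting / non-equivalent
criterion»: r_an = 3 ⇐ (sign, free) ∧ (three points, free) ∧ (no jump) ∧ (L‴ ≠ 0).

RANKED CRUXES. #0 InfinitelyManyRankThreeBSD (target) — LEAF «T-r3An» (route-local, token asked
01:01Z; the identical Prop is the target of route PolyaAxisDoorRankThree, item
stmt-BirchSwinnertonDyer-24264): infinitely many rational elliptic curves, pairwise distinct minimal
discriminants, with Mordell–Weil rank 3 and analytic rank 3. (why it might fail: it is OPEN (no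
infinite family with r_an = 3 exactly is known; even r_an = 2 exactly on an infinite family is
open); it is a consequence of BSD-rank restricted to rank 3, not equivalent to it.)
[BuhlerGrossZagier1985, CremonaAlgorithms1997, Washington1987]
#2 WashingtonSupplyRankThree (crux) — SUPPLY (the ONE open input, the heart): the set of
discriminants of globally minimal models W of the fibres E_t, t = 2s²+2s−1, s ≥ 2, s ≡ 2 (mod 5005),
with rank W(ℚ) ≤ 3 and L‴(W,1) ≠ 0 (third iterated derivative of the entire L-function at 1) is
infinite. [difficulty: open-problem] (why it might fail: rank jumps beyond 3 are frequent on the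
sub-family (kit j295961: rank 5 or 7 on 77 of 241 fibres with |s| ≤ 120) and nothing known controls
«rank ≤ 3 ∧ L‴(E_t,1) ≠ 0» jointly along a thin polynomial family with conductor ≍ s⁸; the member
set could even be finite.) [Washington1987, DelaunayDuquesne2003, Rizzo2003, arXiv:2011.02386,
arXiv:1612.03095]
#3 PublishedInputsWashington (crux) — PRINT PACK (typed Prop hypotheses, names disjoint from LINES
3/4/5): (i) Rizzo 2003: every curve ℚ-isomorphic (VariableChange) to E_t, t ∈ ℤ, has global root
number −1; (ii) L(E,s) is entire for every E/ℚ (BCDT 2001 Thm A; the tree's named fact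
WeierstrassCurve.hasEntireLFunction_rat); (iii) Gross–Zagier–Kolyvagin r_an ≤ 1 ⇒ rank = r_an (the
tree's named fact rank_eq_analyticRank_of_analyticRank_le_one). [difficulty: L] (why it might fail:
(i) must be typed from the local root numbers of the additive fibres (p | t²+3t+9: p ≡ 1 mod 3 or p
= 3, Kodaira IV/IV*; p = 2 good for all t) against the tree's rootNumber definition; a mismatch of
local conventions at 2 or 3 would mis-state w(E_t) for t in some residue class.) [Rizzo2003,
KellockDokchitser2023, BCDTJAMS2001, Darmon2004]
#9 WashingtonThreePoints (support) — THREE POINTS (load-bearing support, provable by a periodic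
kernel certificate): for every integer s ≥ 2 with s ≡ 2 (mod 5005) and every elliptic W ℚ-isomorphic
to E_t(s), 3 ≤ rank W(ℚ) — the points (0,1), (2,2s+1), (−1,2s+1) are independent modulo 2E(ℚ)
because each non-trivial 𝔽₂-combination misses 2·Ẽ(𝔽_q) for some good q ∈ {5,7,11,13} (a finite
check on s mod 5005, kit j296053) and E_t(ℚ) is torsion-free (coprime #Ẽ(𝔽_q)); rank is a
VariableChange invariant (mordellWeilRank_variableChange_holds); the instance s = 2 is the landed
kernel theorem Rank2Observatory.Rank3KernelCerts082.C106276b1.three_le_rank. [difficulty: M]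
[Washington1987, Duquesne2001, CremonaAlgorithms1997, SilvermanAEC2009]
#9 WashingtonDoorKernelRankThree (support) — KERNEL (provable NOW, proved in the seat's
Sketch6.lean): print pack ⇒ for every integer t and every elliptic W ≅ E_t with 3 ≤ rank ≤ 3 and
L‴(W,1) ≠ 0: rank = 3 and r_an(W) = 3 (analyticRank_le_of_iteratedDeriv_ne_zero from (ii)+L‴;
analyticRank_eq_three_of_rootNumber_eq_neg_one from (i), (iii), rank ≥ 2). [difficulty:
provable-now] [CremonaAlgorithms1997, BuhlerGrossZagier1985, Rizzo2003]

TWO-LAYER PLAN. WashingtonSupplyRankThree ⇐ (H) the heart in 2-Selmer form «infinitely many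
progression fibres with finite Sel₂ of order ≤ 8 ∧ L‴ ≠ 0» → (B) #Sel₂ ≤ 8 ⇒ rank ≤ 3
(pow_mordellWeilRank_le_card_selmerGroup) → Supply (registered BC3 skeleton, `_of` proved); below H,
the foreseen split is Washington's dictionary (H1) Sel₂-rank of E_t = 1 + rk₂ Cl(K_t)-part (Thm 1
exact sequence, a typing task over the cubic field ℚ[x]/(x³+tx²−(t+3)x+1)) and (H2) «rk₂ Cl(K_t(s))
= 2 ∧ L‴ ≠ 0 infinitely often» — H2's algebraic half alone («rank E_t(s) = 3 for infinitely many s»,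
class-group statistics of a monogenic cyclic cubic family) is the FRONTIER-bankable rung; nothing of
this is filed until a prover closes Q or the s = 2 rung.

KILL CRITERIA. (a) A fibre t ∈ ℤ with w(E_t) = +1 (root-number census of the observatory, RNCert3
machinery, or Rizzo's proof re-read) ⇒ print pack (i) mis-stated ⇒ restate (sub-progression) or
close refuted:PublishedInputsWashington. (b) A progression fibre s ≡ 2 (mod 5005) where the three
points are dependent (kit j296053 certificate wrong) ⇒ restate Q on a sub-progression. (c) A theorem
that rank E_t(s) ≥ 5 for all but finitely many s in the progression (a fourth generic point on the
sub-family) ⇒ close refuted:WashingtonSupplyRankThree (door empty). (d) r_an = rank proved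
class-wide at rank 3 elsewhere ⇒ superseded.

NOT DECOMPOSED YET. The heart S is not split at open (its Selmer form H and the Selmer⇒rank lemma B
are the registered skeleton; Washington's class-group dictionary H1/H2 waits for a typer of the
cubic field); the per-member certificate (2-descent over K_t with even class number + interval
arithmetic for L‴) is an INSTRUMENT row, not an item; no rank-2 statement is filed (W-62); the
modulus 5005 and residue 2 are the kit-certified choice (any certified progression would do) and s =
2 (t = 11, Cremona 106276b1) is its first fibre.

CHEAPEST FALSIFIER. kit j295961 (DONE, |s| ≤ 120, 241 fibres of t = 2s²+2s−1): root number −1 on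
241/241 (Rizzo ✓); the three points independent on 237/241 (dependent only for s ∈ {−2,−1,0,1});
exact ranks (pari ellrank, lower = upper on all 241): rank 3 on 160, rank 5 on 75, rank 7 on 2, rank
1 on 4 — so «no rank jump» holds on 66 % of fibres in range and FAILS on 32 % (why-might-fail is
real, door not empty); analytic side for the 10 fibres with N < 5·10⁶: r_an = 3 with L‴(E,1) ∈
{65.2, 122.7, 78.4, …} ≠ 0 on all 6 rank-3 fibres (s = 2, 3, 4, …: N = 106276, 1473796, 133956),
r_an = 1 on the 4 rank-1 fibres. kit j296053 (DONE): periodic certificate — primes {5,7,11,13}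
certify independence + torsion-freeness for 1136/5005 residues of s, including s ≡ 2. Instrument row
«Washington fibre»: (s, t, N, w, rank_lo, rank_hi, r_an, L⁽³⁾(1)) — the row refuting the key lemma
is a progression fibre with rank ≤ 3, L‴ certified ≠ 0 and r_an ≠ 3 (impossible by the kernel unless
(i) is false), or w = +1.

NUMBERS. E_t: Δ(E_t) = 16(t²+3t+9)², j = 256(t²+3t+9) (DelaunayDuquesne2003 §2); conductor ≍
16(t²+3t+9)² ≍ 64 s⁸ on the sub-family; first progression fibre s = 2: t = 11, K₁₁ = the cyclic
cubic field of conductor 163, h = 4, Cremona 106276b1 = [0,−1,0,−54,169], rank = 3 (Washington1987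
p.12; kernel lower bound Rank2Observatory.Rank3KernelCerts082.C106276b1.three_le_rank; a RESIDUAL
row of the observatory's rank-3 census: rank ≤ 3 not yet kernel), r_an = 3 with L‴(E,1) ≈ 65.20 (kit
j295961). Door members in range: s = 2, 3, 4 (N = 106276, 1473796, 133956).

DEFINITION REQUESTS. None filed (the family is spelled inline as the Weierstrass tuple ⟨0, t, 0,
−(t+3), 1⟩; a named `washingtonCurve t` and the cubic field K_t = ℚ[x]/(x³+tx²−(t+3)x+1) with its
class-group 2-rank would be Literature definitions under NumberTheory/EllipticCurves if a typer of
Washington1987 Thm 1 prefers them).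

Novelty: Searches (2026-08-28): lit search --hybrid «Washington family elliptic curves simplest cubic fields
rank subfamily» (10 book hits, generic: Silverman, Cornell–Silverman–Stevens, Gouvêa–Yui — none on
the family's ranks); lit vsearch «infinitely many integer fibres of a one-parameter family with
constant root number −1 have rank exactly three and non-vanishing third derivative» (8 generic book
hits); lit search --source all «Delaunay Duquesne numerical investigations derivatives L-series
simplest cubic» → [corpus:paper:doi-10-1080-10586458-2003-10504501] held + crossref Duquesne2001,
Duquesne 2008 (quartic), Byeon 1997 (twists), Kim 2000; lit search --source all «Washington Class
numbers of the simplest cubic fields 1987» → [corpus:paper:doi-10-1090-s0025-5718-1987-0866122-8]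
held, [corpus:paper:arxiv-1507.08324 p.21] Schaefer «Class groups and Selmer groups» (the general
dictionary), [corpus:paper:arxiv-2602.06894] (cubic fields with prescribed class group); lit galaxy
search «Washington's family|simplest cubic fields and elliptic|x^3+tx^2-(t+3)x+1» --star all (24
rows, all noise — no galaxy document on the family); earlier this generation:
[corpus:paper:arxiv-2011.02386 p.2–3, p.14–15] Desjardins (constant root number on integer fibres;
rank elevation conditional on parity), BDD arXiv:1612.03095; tree: rg Theses for
«Rizzo|Washington|constant root number|simplest cubic» (8 files, all Ferrero–Washington /
Washington1997 / Rizzo's Table II inside root-number certificates — no r  [refs: 1612.03095, 2011.02386, paper:doi-10-1080-10586458-2003-10504501, paper:doi-10-1090-s0025-5718-1987-0866122-8, paper:arxiv-1507.08324, paper:arxiv-2602.06894, paper:arxiv-2011.02386, Duquesne2001, Washington1997, Washington1987, Rizzo2003, DelaunayDuquesne2003]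

Barriers (technique_class: constant-sign-family, periodic-certificate, rank-window): - technique_class: constant-sign-family, periodic-certificate, rank-window
- Literature.Barriers.BirchSwinnertonDyer.NumericalVanishingBarrier: OUTSIDE — no vanishing of any
L-value or derivative is ever decided numerically; members need only the strict inequality L‴(W,1) ≠
0 (an open condition, interval-certifiable per member as in Curve5077aLambdaThirdDerivPos), and the
lower bound r_an ≥ 3 comes from algebra (three points + GZK + odd parity from Rizzo's theorem).
- Literature.Barriers.BirchSwinnertonDyer.FunctionalEquationSeesOnlyParity: respected — the sign is
used exactly for what it sees, the parity of r_an (w = −1 ⇒ odd, unconditional tree theorem), and it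
is supplied by a THEOREM about the family (Rizzo), not computed per curve; the missing bit (≤ 3)
comes from L‴ ≠ 0, the bit (≥ 2) from GZK.
- Literature.Barriers.BirchSwinnertonDyer.HeegnerPointBarrier: respected — Heegner points / GZK
enter only through the proved range r_an ≤ 1 (contrapositive: rank ≥ 2 ⇒ r_an ≥ 2); nothing at rank
3 is asked of them.
- Literature.Barriers.BirchSwinnertonDyer.DokchitserDokchitser2011_rankMod_notSumOfLocalInvariants:
not applicable — no local formula for the RANK is claimed; the product of local signs gives the
analytic root number (its definition), and the rank bounds come from explicit points and 2-descent.
- Negatives index: `ledger negatives --problem BirchSwinnertonDyer` (read gen 0–3): no refuted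
statement concerns Washington's family, constant-root-number families, or the r_a

History (route lifecycle, newest last):
- 2026-08-28T02:49:28Z · closes_target -> closes rung T-r3A of BirchSwinnertonDyer: Summit.BirchSwinnertonDyer.BirchSwinnertonDyer.Theses.PolyaAxisDoorRankThree.InfinitelyManyRankThreeBSD (D-0061; not the summit Statement) (planner-bsd-idea-4-g4-0)

sub-problem: BirchSwinnertonDyer · status: draft · opened planner-bsd-idea-4-g3-0 2026-08-28T01:28:08Z · rev 1 · ledger route-BirchSwinnertonDyer-WashingtonSignFamilyDoorRankThree
GENERATED by the gate from the ledger (D-0016/17). Provers cite these decls: `theorem foo : Summit.BirchSwinnertonDyer.BirchSwinnertonDyer.Theses.WashingtonSignFamilyDoorRankThree.<Decl> := …` in Summits/BirchSwinnertonDyer/BirchSwinnertonDyer/Theorems/<Name>.lean.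
-/

namespace Summit.BirchSwinnertonDyer.BirchSwinnertonDyer.Theses.WashingtonSignFamilyDoorRankThree

open scoped BigOperators Topology Manifold Classical MeasureTheory ProbabilityTheory Matrix InnerProductSpace ComplexConjugate ContinuousMap
open Filter Set Function TopologicalSpace MeasureTheory

attribute [summit_statement] _root_.BirchSwinnertonDyer
attribute [summit_statement] _root_.Summit.BirchSwinnertonDyer.BirchSwinnertonDyer.Theses.PolyaAxisDoorRankThree.InfinitelyManyRankThreeBSD

open Literature

/-- item stmt-BirchSwinnertonDyer-24264 · target · rank 0 · open · by planner
why it might fail: it is OPEN (no infinite family with r_an = 3 exactly is known; even r_an = 2 exactly on an infinite family is open); it is a consequence of BSD-rank restricted to rank 3, not equivalent to it.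
sources: BuhlerGrossZagier1985, CremonaAlgorithms1997, Washington1987
[target] LEAF «T-r3An» (route-local, token ruling asked): infinitely many rational elliptic curves,
pairwise distinct minimal discriminants, with Mordell–Weil rank 3 and analytic rank 3 (the rank part
of BSD on an infinite rank-3 set; no such infinite set is known today — every known r_an = 3 is a
per-curve derivative certificate). -/
@[route_item "route-BirchSwinnertonDyer-WashingtonSignFamilyDoorRankThree"]
def InfinitelyManyRankThreeBSD : Prop :=
  {Δ : ℚ | ∃ (W : WeierstrassCurve ℚ) (_ : W.IsElliptic) (_ : W.IsGloballyMinimal), W.Δ = Δ ∧ W.mordellWeilRank = 3 ∧ W.analyticRank = 3}.Infinite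

/-- item stmt-BirchSwinnertonDyer-24434 · crux · rank 2 · open · by planner
why it might fail: rank jumps beyond 3 are frequent on the sub-family (kit j295961: rank 5 or 7 on 77 of 241 fibres with |s| ≤ 120) and nothing known controls «rank ≤ 3 ∧ L‴(E_t,1) ≠ 0» jointly along a thin polynomial family with conductor ≍ s⁸; the member set could even be finite.
sources: Washington1987, DelaunayDuquesne2003, Rizzo2003, arXiv:2011.02386, arXiv:1612.03095
[crux] SUPPLY (the ONE open input, the heart): the set of discriminants of globally minimal models W
of the fibres E_t, t = 2s²+2s−1, s ≥ 2, s ≡ 2 (mod 5005), with rank W(ℚ) ≤ 3 and L‴(W,1) ≠ 0 (third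
iterated derivative of the entire L-function at 1) is infinite. [difficulty: open-problem] -/
@[route_item "route-BirchSwinnertonDyer-WashingtonSignFamilyDoorRankThree", crux]
def WashingtonSupplyRankThree : Prop :=
  {Δ : ℚ | ∃ (s : ℤ) (W : WeierstrassCurve ℚ) (_ : W.IsElliptic) (_ : W.IsGloballyMinimal), s ≡ 2 [ZMOD 5005] ∧ 2 ≤ s ∧ (∃ c : WeierstrassCurve.VariableChange ℚ, W = c • (⟨0, ((2 * s ^ 2 + 2 * s - 1 : ℤ) : ℚ), 0, -(((2 * s ^ 2 + 2 * s - 1 : ℤ) : ℚ) + 3), 1⟩ : WeierstrassCurve ℚ)) ∧ W.Δ = Δ ∧ W.mordellWeilRank ≤ 3 ∧ iteratedDeriv 3 W.entireLFunction 1 ≠ 0}.Infinite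

/-- item stmt-BirchSwinnertonDyer-24435 · crux · rank 3 · open · by planner
why it might fail: (i) must be typed from the local root numbers of the additive fibres (p | t²+3t+9: p ≡ 1 mod 3 or p = 3, Kodaira IV/IV*; p = 2 good for all t) against the tree's rootNumber definition; a mismatch of local conventions at 2 or 3 would mis-state w(E_t) for t in some residue class.
sources: Rizzo2003, KellockDokchitser2023, BCDTJAMS2001, Darmon2004
[crux] PRINT PACK (typed Prop hypotheses, names disjoint from LINES 3/4/5): (i) Rizzo 2003: every
curve ℚ-isomorphic (VariableChange) to E_t, t ∈ ℤ, has global root number −1; (ii) L(E,s) is entire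
for every E/ℚ (BCDT 2001 Thm A; the tree's named fact WeierstrassCurve.hasEntireLFunction_rat);
(iii) Gross–Zagier–Kolyvagin r_an ≤ 1 ⇒ rank = r_an (the tree's named fact
rank_eq_analyticRank_of_analyticRank_le_one). [difficulty: L] -/
@[route_item "route-BirchSwinnertonDyer-WashingtonSignFamilyDoorRankThree", crux]
def PublishedInputsWashington : Prop :=
  (∀ (t : ℤ) (W : WeierstrassCurve ℚ) [W.IsElliptic], (∃ c : WeierstrassCurve.VariableChange ℚ, W = c • (⟨0, (t : ℚ), 0, -((t : ℚ) + 3), 1⟩ : WeierstrassCurve ℚ)) → W.rootNumber = -1) ∧ WeierstrassCurve.hasEntireLFunction_rat ∧ NumberTheory.EllipticCurves.rank_eq_analyticRank_of_analyticRank_le_one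

/-- item stmt-BirchSwinnertonDyer-24436 · support · rank 9 · open · by planner
sources: Washington1987, Duquesne2001, CremonaAlgorithms1997, SilvermanAEC2009
[support] THREE POINTS (load-bearing support, provable by a periodic kernel certificate): for every
integer s ≥ 2 with s ≡ 2 (mod 5005) and every elliptic W ℚ-isomorphic to E_t(s), 3 ≤ rank W(ℚ) — the
points (0,1), (2,2s+1), (−1,2s+1) are independent modulo 2E(ℚ) because each non-trivial
𝔽₂-combination misses 2·Ẽ(𝔽_q) for some good q ∈ {5,7,11,13} (a finite check on s mod 5005, kit
j296053) and E_t(ℚ) is torsion-free (coprime #Ẽ(𝔽_q)); rank is a VariableChange invariant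
(mordellWeilRank_variableChange_holds); the instance s = 2 is the landed kernel theorem
Rank2Observatory.Rank3KernelCerts082.C106276b1.three_le_rank. [difficulty: M] -/
@[route_item "route-BirchSwinnertonDyer-WashingtonSignFamilyDoorRankThree", crux]
def WashingtonThreePoints : Prop :=
  ∀ (s : ℤ), s ≡ 2 [ZMOD 5005] → 2 ≤ s → ∀ (W : WeierstrassCurve ℚ) [W.IsElliptic], (∃ c : WeierstrassCurve.VariableChange ℚ, W = c • (⟨0, ((2 * s ^ 2 + 2 * s - 1 : ℤ) : ℚ), 0, -(((2 * s ^ 2 + 2 * s - 1 : ℤ) : ℚ) + 3), 1⟩ : WeierstrassCurve ℚ)) → 3 ≤ W.mordellWeilRank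

/-- item stmt-BirchSwinnertonDyer-24437 · support · rank 9 · closed · proved by Summit.BirchSwinnertonDyer.BirchSwinnertonDyer.Theorems.washingtonDoorKernelRankThree_proof (planner) · by planner
sources: CremonaAlgorithms1997, BuhlerGrossZagier1985, Rizzo2003
[support] KERNEL (provable NOW, proved in the seat's Sketch6.lean): print pack ⇒ for every integer t
and every elliptic W ≅ E_t with 3 ≤ rank ≤ 3 and L‴(W,1) ≠ 0: rank = 3 and r_an(W) = 3
(analyticRank_le_of_iteratedDeriv_ne_zero from (ii)+L‴;
analyticRank_eq_three_of_rootNumber_eq_neg_one from (i), (iii), rank ≥ 2). [difficulty: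
provable-now] -/
@[route_item "route-BirchSwinnertonDyer-WashingtonSignFamilyDoorRankThree", crux]
def WashingtonDoorKernelRankThree : Prop :=
  PublishedInputsWashington → ∀ (t : ℤ) (W : WeierstrassCurve ℚ) [W.IsElliptic], (∃ c : WeierstrassCurve.VariableChange ℚ, W = c • (⟨0, (t : ℚ), 0, -((t : ℚ) + 3), 1⟩ : WeierstrassCurve ℚ)) → 3 ≤ W.mordellWeilRank → W.mordellWeilRank ≤ 3 → iteratedDeriv 3 W.entireLFunction 1 ≠ 0 → W.mordellWeilRank = 3 ∧ W.analyticRank = 3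

-- `WashingtonDoorKernelRankThree` holds: proved by `Summit.BirchSwinnertonDyer.BirchSwinnertonDyer.Theorems.washingtonDoorKernelRankThree_proof` (its module imports this route file, so no `_holds` link can be stated here).

/-- item stmt-BirchSwinnertonDyer-24438 · assembly · rank 1 · closed · proved by Summit.BirchSwinnertonDyer.BirchSwinnertonDyer.Theorems.washingtonAssembly_proof (planner) · by planner
sources: Washington1987, Rizzo2003
[assembly] Supply → Three points → Print pack → Kernel → the leaf InfinitelyManyRankThreeBSD (pure
logic: Set.Infinite.mono + the kernel pointwise). -/
@[route_item "route-BirchSwinnertonDyer-WashingtonSignFamilyDoorRankThree"]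
def Assembly : Prop :=
  WashingtonSupplyRankThree → WashingtonThreePoints → PublishedInputsWashington → WashingtonDoorKernelRankThree → InfinitelyManyRankThreeBSD

-- `Assembly` holds: proved by `Summit.BirchSwinnertonDyer.BirchSwinnertonDyer.Theorems.washingtonAssembly_proof` (its module imports this route file, so no `_holds` link can be stated here).

/-! D-0027 §2.1 — DECIDING THEOREM (planner-authored via `route open/edit --closes-file`; by planner-bsd-idea-4-g4-0 2026-08-28T02:49:28Z):
its hypotheses are this route's items and its conclusion the registered leaf `Summit.BirchSwinnertonDyer.BirchSwinnertonDyer.Theses.PolyaAxisDoorRankThree.InfinitelyManyRankThreeBSD` (rung T-r3A, D-0061) (glue_lint), and it elaborates with this file. -/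

@[closes "route-BirchSwinnertonDyer-WashingtonSignFamilyDoorRankThree"] theorem closes (hS : WashingtonSupplyRankThree) (hQ : WashingtonThreePoints)
    (hP : PublishedInputsWashington) (hK : WashingtonDoorKernelRankThree) :
    Summit.BirchSwinnertonDyer.BirchSwinnertonDyer.Theses.PolyaAxisDoorRankThree.InfinitelyManyRankThreeBSD := by
  refine Set.Infinite.mono ?_ hS
  rintro Δ ⟨s, W, hE, hM, hmod, hs, hiso, hΔ, hup, hL⟩
  have hlow : 3 ≤ W.mordellWeilRank := hQ s hmod hs W hiso
  obtain ⟨hr, han⟩ := hK hP (2 * s ^ 2 + 2 * s - 1) W hiso hlow hup hL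
  exact ⟨W, hE, hM, hΔ, hr, han⟩

end Summit.BirchSwinnertonDyer.BirchSwinnertonDyer.Theses.WashingtonSignFamilyDoorRankThree
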